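import Mathlib
import HarnessLib

/-!
# K. Joshi, *Arithmetic Teichmüller spaces III* (arXiv:2401.13508v4) §6.1–§6.4: descent of holomorphoid data (Thm. 6.1.1), the
# adelic shape of `Θ̃_Joshi` (§6.2), a Θ_gau-link as an `ℓ⋇`-tuple of distinct holomorphoids (Thm. 6.3.1), collation / lifting /
# ADMISSIBLE LIFTS of theta-values (§6.4, Def. 6.4.3.1) — typed over abstract carriers

Record file of the abc-iut cell, BLOCK E «type Joshi's construction, test vs S» (rung LADDER-ABC:A2.E; human ruling D-0078; seat abc-iut-E-t10, slot T-10 of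
`plan/E/ASSIGNMENTS.md`; inventory `plan/E/t10/INVENTORY.tsv`, one row per item below). Source of record: the cell's render
`HOME/lit/renders/Joshi-arxiv-2401.13508/pNNNN.txt` (PDF page `N` = printed page; «p.N l.M» = line `M` of that file) of [J-III] = K. Joshi, *Construction of
Arithmetic Teichmüller Spaces III*, arXiv:2401.13508 **v4** (unrefereed «preliminary version for comments»; bib `Joshi2024ATS3`; rejected by the IUT author
[Mochizuki2024JoshiReport]; accepted by neither side of the dispute, D-0012). TAKES NO SIDE on [IUTchIII] Cor. 3.12, on Joshi's claims, or on Mochizuki's report.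
TYPED ≠ PROVED ≠ ENDORSED: Joshi's DATA are structures / defs with the printed locator; every statement he ASSERTS is a `Prop`-valued `def` tagged
`@[claim "Joshi2024ATS3" "disputed"]`, never an axiom, instance, `sorry` or Literature fact; what FOLLOWS from the typed signature is a proved `theorem` («discharged»). No
FACT-LIST row is consumed; no `Summits.*` file is imported (this block names no object of OUR Cor. 3.12 interface in kernel — see DICTIONARY — so none is restated).

## Contents (PDF pp. 42–48)
* §6.1 Thm. 6.1.1 (p.43 l.3–52): an arithmeticoid `y = (y′_w)_w ∈ 𝒴_{L′} = ∏_{w ∈ V_{L′}} |Y_{ℂ_p^♭,L′_w}|` descends along the fixed bijection `V_{L_mod} ≃ V ⊂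
  V_{L′}` (§3.3 (14)) to `y̲ = (f_{w|v}(y′_w))_v ∈ 𝒴_{L_mod}` [FF18 Prop. 2.3.20] — `ModuliDescentDatum.descend`, claim `Thm611`, proof `thm611_holds` (it is a
  construction).
* §6.2 (p.43 l.57–68): `Θ̃^?_Joshi = ∏_p Θ̃^?_{Joshi,p}` — `adelicLocus` (the local pieces, §6.6–§6.10, are slot T-11's, NOT here).
* §6.3, Thm. 6.3.1 (p.44 l.28–p.45 l.8): a point `z = (y_1,…,y_{ℓ⋇})` of Mochizuki's Adelic Ansatz `Σ̃_{L′}` (a Θ_gau-link, Def. 4.2.3.1) is an `ℓ⋇`-tuple of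
  arithmeticoids / holomorphoids `X/arith(L′)_{y_j}`, ALL DISTINCT — `CollationDatum.adelicAnsatz` (Def. 4.2.2 restated minimally), claim `Thm631`, and
  `thm631_of_valuationScaling` deriving it from Thm. 4.2.2.1 (4) typed as the hypothesis `ValuationScaling`.
* §6.4 (6.4.1), §6.4.1 (p.45 l.9–p.46 l.30): the Tate-parameter tuple to be COLLATED, the `w`-component, `E′_w = L′_w` — `tateTuple`, `wComponent`,
  `wComponent_mem_localAnsatz`.
* §6.4.2 (p.46 l.34–p.47 l.17): Teichmüller lifts `[z] ∈ W_{O_E}(O_{ℂ_p^♭}) ⊂ B_E` of the theta value `ξ_1 ∈ K_{y′}` with `|[z]|_ρ = |z|_{ℂ_p^♭} = |ξ|_K` ([J-IIp]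
  Thm. 8.1.1), the Tate module `T(𝒢(O_K)) = O_E·t_{K_{y′}} ⊂ B_E^{φ=π}` [FF18 Ch. 4], the LIFTS OF INTEREST (6.4.2.1) `Ξ = [z] + O_E·t_{K_{y′}}`, Rmk. 6.4.2.2 —
  `ThetaLiftDatum`, `IsTeichLift`, claim `TeichLiftExists`, `liftSet`, `Rmk6422` (+ `rmk6422_holds`).
* §6.4.3 Def. 6.4.3.1 (p.47 l.18–p.48 l.16): ADMISSIBLE LIFT `Ξ_{λ,z,w} = ([z_j] + i_j(λ) t_{K_{y′_j}})_{j=1..ℓ⋇} ∈ B_E^{ℓ⋇}`, ONE `λ ∈ O_E` — `admissibleLift`,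
  `IsAdmissibleLift(At)`, `admissibleLifts`, and the DERIVED reduction `ψ_j(Ξ_j) = ξ_{1;K_{y′_j}}` (`resid_admissibleLift`; = the first equality of Prop. 6.6.1,
  slot T-11).

## Reading notes for the referee lanes (own render; no adjudication)
(a) Def. 6.4.3.1 multiplies `i_j(λ) ∈ K_{y′_j}` (`i_j : E ↪ K_{y′_j}`, p.47 l.33–41) with `t_{K_{y′_j}} ∈ B_E`; this is only meaningful as the `O_E`-module action
on `T(𝒢(O_K)) ⊂ B_E^{φ=π}` («free `O_E`-submodule of rank one», p.46 l.60–61; (6.4.2.1) writes `O_E·t`), which is what is typed (`λ • t` via `Algebra O_E B_E`). (b)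
ONE `λ` for all `j` (p.47 l.62–63); contrast [J-IIp] arXiv:2303.01662 (8.2.2.1), independent `τ_j ∈ T_{y_j}`. (c) p.47 l.66–70 prints «ξ_{1;K_{y′_1}}, …,
ξ_{1;K_{y′_1}}» — index slip for `…, ξ_{1;K_{y′_{ℓ⋇}}}` (cf. l.71–74); typed with `j`. (d) Thm. 6.3.1's «need not even provide isomorphic pairs of analytic spaces
at any prime» (p.45 l.4–6) is untypable prose. (e) Residue fields are typed CONCRETELY as `B_E ⧸ 𝔪_{y′}`, `ψ_{y′} = Ideal.Quotient.mk` («natural quotient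
homomorphism», Prop. 6.6.1, p.48 l.37–41).

## DICTIONARY (heading E3; Joshi's own sentences, recorded not endorsed)
D-t10-1 (Rmk. 6.4.3.3, p.48 l.14–16): «each `Ξ_{λ,z,w}` is the analog of Mochizuki's Θ-Pilot Object [IUTchIII, Def. 3.8 (i)]» ↔ OUR
`Summit.ABC.IUTFork.Cor312.Setting.thetaPilot` and its bad-place Kummer images `(S.col P.n).frobΨ m v` / regions `thetaRegion m j v_ℚ` (`j` ↔ label `j ∈ T.Label ∖
{0}`, `w ∈ V^{odd,ss}` ↔ `v ∈ T.Vbad`). D-t10-2 (p.45 l.9–10): «in Mochizuki's parlance, each `z` is a Θ-Link» ↔ the horizontal arrow of `Cor312.Setting.lattice`.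
D-t10-3 (p.44 l.19–21): «Mochizuki forces multiplication of theta-values by means of his theory of tensor packets» ↔ `Thm311.LogShells` packets `S.L.Packet j v_ℚ`
vs Joshi's RING `B_E^{ℓ⋇}` (a different kind of container). NO q-pilot Kummer datum (our binder `qK` of `Cor312Vol.PilotKummerIndRelated`) occurs in §6.1–§6.4: this
block is a CARRIER (class P1) and states no test vs S.

## Merge-debts (interim carrier rule, plan/E/ASSIGNMENTS.md §0.3)
`ModuliDescentDatum` / `CollationDatum` duplicate the adelic Fargues–Fontaine curve `𝒴_{L′}` of [Joshi 2023a] (E-t1) and Def. 4.2.2 / Def. 4.2.1.6 / Thm. 4.2.2.1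
(4) of §4.2 (slot T-07; here only the hypothesis `ValuationScaling`); `ThetaLiftDatum` duplicates E-t3's `PeriodRingDatum` ([J-IIp] §2, §7) and the §5 rings of slot
T-09. Holomorphoids of the FIXED `X` are labelled by their arithmeticoids (Def. 2.1.2 / 2.1.5 (5): `hol(X/L)_y` «given by the arithmeticoid `arith(L)_y`»; slot T-05
owns the structure).
-/

namespace Summit.ABC.IUTFork.Joshi.ATS3

/-! ## §6.1 Descent of holomorphoid data to `L_mod` (Thm. 6.1.1) -/

/-- Carrier for [J-III] §6.1 (p.43 l.1–52): the valuation sets `V_{L′}` and `V_{L_mod}` (§3.2 (5)), the divisibility relation `w | v`, the fixed bijection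
`V_{L_mod} ≃ V ⊂ V_{L′}` of §3.3 (14) typed as a choice `sel v ∈ V_{L′}` of one `w` over each `v`, the closed classical points `|Y_{ℂ_p^♭, L′_w}|` and `|Y_{ℂ_p^♭,
L_mod,v}|`, and the natural continuous finite-fibre maps `f_{w|v} : |Y_{ℂ_p^♭,L′_w}| → |Y_{ℂ_p^♭,L_mod,v}|` of [Fargues–Fontaine 2018, Prop. 2.3.20] (p.43 l.29–46).
An ARITHMETICOID `arith(L′)_y` is a point `y ∈ 𝒴_{L′} = ∏_{w ∈ V_{L′}} |Y_{ℂ_p^♭,L′_w}|` (p.43 l.14–25, «by definition ([Joshi, 2023a, § 4])»). SIGNATURE only;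
nothing asserted. [claim: Joshi2024ATS3, status: disputed] -/
structure ModuliDescentDatum : Type 1 where
  /-- `V_{L′}`: equivalence classes of valuations of `L′` (§3.2 (5), (8)). -/
  VL' : Type
  /-- `V_{L_mod}`: equivalence classes of non-archimedean valuations of the field of moduli `L_mod` (§3.1 (4), §3.2 (5)). -/
  Vmod : Type
  /-- `w | v`: the valuation `w` of `L′` lies over the valuation `v` of `L_mod`. -/
  LiesOver : VL' → Vmod → Prop
  /-- the fixed bijection `V_{L_mod} ≃ V ⊂ V_{L′}` (§3.3 (14)): the chosen `w ∈ V` over `v`. -/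
  sel : Vmod → VL'
  /-- the chosen `w` lies over `v`. -/
  sel_liesOver : ∀ v, LiesOver (sel v) v
  /-- `V ≃ V_{L_mod}` is a bijection onto its image: `sel` is injective. -/
  sel_injective : Function.Injective sel
  /-- `|Y_{ℂ_p^♭, L′_w}|`: closed classical points of the Fargues–Fontaine curve for `(ℂ_{p_w}^♭, L′_w)`. -/
  Y : VL' → Type
  /-- `|Y_{ℂ_p^♭, L_mod,v}|`. -/
  Ymod : Vmod → Type
  /-- `f_{w|v}` [FF18 Prop. 2.3.20] (p.43 l.31–46), for every `w | v`. -/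
  proj : ∀ (w : VL') (v : Vmod), LiesOver w v → Y w → Ymod v

namespace ModuliDescentDatum

variable (M : ModuliDescentDatum)

/-- An arithmeticoid of `L′` = a point of `𝒴_{L′} = ∏_w |Y_{ℂ_p^♭,L′_w}|` (p.43 l.14–25). [claim: Joshi2024ATS3, status: disputed] -/
abbrev Arith : Type := ∀ w : M.VL', M.Y w

/-- An arithmeticoid of `L_mod` = a point of `𝒴_{L_mod}`. [claim: Joshi2024ATS3, status: disputed] -/
abbrev ArithMod : Type := ∀ v : M.Vmod, M.Ymod v

/-- Thm. 6.1.1's CONSTRUCTION (proof, p.43 l.26–52): `y̲ := (f_{w|v}(y′_w))_{v}` with `w = sel v` the valuation of `V` over `v` — «the point obtained by projection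
of `y = (y′_w)_{w ∈ V_{L′}}` on to the coordinates corresponding to the "index" set identified by `V ≃ V_{L_mod}` using the natural (continuous) mapping `f_{w|v}`».
§6.1.1 (p.43 l.53–56): «underlined versions of objects will refer to objects arising from arithmeticoid `arith(L_mod)_{y̲}`». [claim: Joshi2024ATS3, status:
disputed] -/
def descend (y : M.Arith) : M.ArithMod := fun v => M.proj (M.sel v) v (M.sel_liesOver v) (y (M.sel v))

/-- **[J-III] Thm. 6.1.1** (p.43 l.3–11): «(1) the bijection `V_{L_mod} ≃ V ⊂ V_{L′}` together with the arithmeticoid `y` provides us with an arithmeticoid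
`arith(L_mod)_{y̲}` with `y̲ ∈ 𝒴_{L_mod}` naturally given using `y` and the above bijection. (2) In particular, every holomorphoid `hol(X/L′)_y` of `X/L′` provides
us an arithmeticoid `arith(L_mod)_{y̲}` of `L_mod`.» Typed: for every `y` there is a `y̲` whose `v`-coordinate is `f_{sel v | v}(y′_{sel v})`; (2) is (1) composed
with `hol ↦ arith(hol)` (Def. 2.1.5 (3)). -/
@[claim "Joshi2024ATS3" "disputed"]
def Thm611 : Prop :=
  ∀ y : M.Arith, ∃ ymod : M.ArithMod, ∀ v : M.Vmod, ymod v = M.proj (M.sel v) v (M.sel_liesOver v) (y (M.sel v))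

/-- Thm. 6.1.1 HOLDS over the typed signature: it is a construction (`descend`). DISCHARGED row. [claim: Joshi2024ATS3, status: disputed] -/
theorem thm611_holds : M.Thm611 := fun y => ⟨M.descend y, fun _ => rfl⟩

end ModuliDescentDatum

/-! ## §6.2 The adelic shape of `Θ̃^?_Joshi` -/

/-- [J-III] §6.2 (p.43 l.57–68): «The construction of the set `Θ̃^?_Joshi` is adelic and it will be constructed here by constructing subsets `Θ̃^?_{Joshi,p}` for
every prime `p` and then taking product over all rational primes `p`.» Generic assembly: given, for each index `p`, a container `C p` and a local piece `Θ p ⊆ C p`,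
the adelic set is the product `∏_p Θ p ⊆ ∏_p C p`. The local pieces themselves (`Θ̃^{B_E}_w`, `Θ̃^{B_{L′}}`, §6.6–§6.10) are slot T-11's, not typed here. [claim:
Joshi2024ATS3, status: disputed] -/
def adelicLocus {P : Type*} {C : P → Type*} (Θ : ∀ p : P, Set (C p)) : Set (∀ p : P, C p) := Set.univ.pi Θ

/-- Membership in the adelic set is componentwise membership. [claim: Joshi2024ATS3, status: disputed] -/
theorem mem_adelicLocus_iff {P : Type*} {C : P → Type*} (Θ : ∀ p : P, Set (C p)) (x : ∀ p : P, C p) :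
    x ∈ adelicLocus Θ ↔ ∀ p : P, x p ∈ Θ p := by
  simp [adelicLocus]

/-! ## §6.3–§6.4.1 The Adelic Ansatz point as an `ℓ⋇`-tuple of holomorphoids; Thm. 6.3.1; the `w`-component -/

/-- Carrier for [J-III] §6.3–§6.4.1 (p.44 l.28–p.46 l.30), with the §4.2 data it quotes: `ℓ⋇ = (ℓ−1)/2` (§3.3 (11)); `V_{L′}` with the subset `V^{odd,ss}` (§3.2
(6), §3.4: odd residue characteristic, `X` has split multiplicative reduction); the closed classical points `|Y_{ℂ_{p_w}^♭, L′_w}|` with, for `y_w`, the absolute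
value `|p_w|_{K_{y_w}} ∈ (0,1)` of the residue characteristic in the residue field `K_{y_w}` (§4.2, p.31 l.3–13: `K_{y_w}` a perfectoid field, `K^♭_{y_w}` of
characteristic `p_w > 0`); and MOCHIZUKI'S LOCAL ANSATZ `Σ̃_{ℂ_p^♭, L′_w} ⊂ Y^{ℓ⋇}_{ℂ_p^♭, L′_w}` (Def. 4.2.1.6; construction §4.2.1 = inverse image of the
primitive ansatz of [J-IIp] §6). Tuples indexed `j = 1, …, ℓ⋇` are typed on `Fin ℓ⋇` (index `i ↦ j = i + 1`). SIGNATURE; the local Ansatz is slot T-07's object,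
carried as an abstract field (merge-debt). [claim: Joshi2024ATS3, status: disputed] -/
structure CollationDatum : Type 1 where
  /-- `ℓ⋇ = (ℓ − 1)/2`, `ℓ ≥ 5` prime (§3.3 (11)). -/
  lstar : ℕ
  /-- `V_{L′}`. -/
  V : Type
  /-- `V^{odd,ss} ⊂ V_{L′}` (§3.2 (6), §3.4). -/
  Voddss : Set V
  /-- `|Y_{ℂ_{p_w}^♭, L′_w}|`, closed classical points (§4.1 (4.1.1)). -/
  Y : V → Type
  /-- `|p_w|_{K_{y}}`: absolute value of the residue characteristic in the residue field of the point `y` (§4.2 p.31 l.3–13). -/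
  normP : ∀ w : V, Y w → ℝ
  /-- `0 < |p_w|_{K_y} < 1` (`K_y` is an untilt of `ℂ_{p_w}^♭` over `L′_w ⊃ ℚ_{p_w}`: `p_w ≠ 0` is topologically nilpotent). -/
  normP_pos_lt_one : ∀ (w : V) (y : Y w), 0 < normP w y ∧ normP w y < 1
  /-- Mochizuki's local Ansatz `Σ̃_{ℂ_p^♭, L′_w} ⊂ Y^{ℓ⋇}_{ℂ_p^♭,L′_w}` (Def. 4.2.1.6, p.32 l.46–68). -/
  localAnsatz : ∀ w : V, Set (Fin lstar → Y w)

namespace CollationDatum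

variable (A : CollationDatum)

/-- An arithmeticoid of `L′` = a point `y = (y_w)_{w ∈ V_{L′}}` of `𝒴′_{L′} = ∏_p ∏_{w|p} |Y_{ℂ_p^♭,L′_w}|` (§4.1 (4.1.1), p.30 l.29–44); for the FIXED curve `X`,
the holomorphoid `hol(X/L′)_y = X/arith(L′)_y` is labelled by it (Def. 2.1.2, 2.1.5 (5)). [claim: Joshi2024ATS3, status: disputed] -/
abbrev Arith : Type := ∀ w : A.V, A.Y w

/-- §6.4.1 (p.45 l.43–45) / §4.2 (p.31 l.36–47): the `w`-COMPONENT `z_w = (y_{w,1}, …, y_{w,ℓ⋇}) ∈ Y^{ℓ⋇}_{ℂ_p^♭,L′_w}` of an `ℓ⋇`-tuple `z = (y_1, …, y_{ℓ⋇})` of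
adelic points. [claim: Joshi2024ATS3, status: disputed] -/
def wComponent (z : Fin A.lstar → A.Arith) (w : A.V) : Fin A.lstar → A.Y w := fun j => z j w

/-- **Mochizuki's Adelic Ansatz `Σ̃_{L′} ⊂ (𝒴′_{L′})^{ℓ⋇}`** ([J-III] Def. 4.2.2 (4.2.3), p.31 l.51–67, restated minimally — slot T-07 owns it): `z ∈ Σ̃_{L′}` iff
`z_w = (y_w, y_w, …, y_w)` is DIAGONAL for `w ∈ V_{L′} − V^{odd,ss}` and `z_w ∈ Σ̃_{ℂ_p^♭,L′_w}` (the local Ansatz) for `w ∈ V^{odd,ss}`. Its points are the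
Θ_gau-LINKS (Def. 4.2.3.1, Rmk. 4.2.3.2 (1): «a Θ_gau-Link is simply a point of Mochizuki's Adelic Ansatz»; §6.4 p.45 l.9–10: «in Mochizuki's parlance, each `z` is
a Θ-Link»). [claim: Joshi2024ATS3, status: disputed] -/
@[claim "Joshi2024ATS3" "disputed"]
def adelicAnsatz : Set (Fin A.lstar → A.Arith) :=
  {z | (∀ w ∈ A.Voddss, A.wComponent z w ∈ A.localAnsatz w) ∧ (∀ w ∉ A.Voddss, ∀ i j : Fin A.lstar, z i w = z j w)}

/-- §6.4.1 (p.45 l.43–p.46 l.30): for `z ∈ Σ̃_{L′}` and `w ∈ V^{odd,ss}_p`, the `w`-component `(y′_1, …, y′_{ℓ⋇}) := (y_{w,1}, …, y_{w,ℓ⋇})` lies in the local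
Ansatz `Σ̃^{E′_w}_{ℂ_p^♭}` (`E′_w := L′_w`), and the `ℓ⋇`-tuple of LOCAL holomorphoids (6.4.1.1) lying over it is «our Θ_gau-Link». DERIVED from Def. 4.2.2 as
typed. [claim: Joshi2024ATS3, status: disputed] -/
theorem wComponent_mem_localAnsatz {z : Fin A.lstar → A.Arith} (hz : z ∈ A.adelicAnsatz) {w : A.V} (hw : w ∈ A.Voddss) :
    A.wComponent z w ∈ A.localAnsatz w := hz.1 w hw

/-- **[J-III] Thm. 4.2.2.1 (4)** (p.33 l.3–36), typed as a HYPOTHESIS on the carrier (slot T-07's claim; merge-debt): for `(y′_1, …, y′_{ℓ⋇}) ∈ Σ̃_{L′}` and `w ∈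
V^{odd,ss}`, the residue fields of the `w`-components satisfy `|−|_{K_{y′_{w,j}}} = |−|^{j²}_{K_{y′_{w,1}}}` («valuation scaling», proof via [J-IIp] Prop. 6.7.1 /
Thm. 6.9.1), read on the residue characteristic: there is `c` (`= |p|_{K_{y′_{w,1}}}`) with `|p|_{K_{y′_{w,j}}} = c^{j²}` for `j = 1, …, ℓ⋇` (`0 < c`: it is an
absolute value of `p ≠ 0`). -/
@[claim "Joshi2024ATS3" "disputed"]
def ValuationScaling : Prop :=
  ∀ z ∈ A.adelicAnsatz, ∀ w ∈ A.Voddss, ∃ c : ℝ, 0 < c ∧ ∀ i : Fin A.lstar, A.normP w (z i w) = c ^ ((i.val + 1) ^ 2)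

/-- **[J-III] Thm. 6.3.1** (p.45 l.2–8): «For any `z = (y_1, …, y_{ℓ⋇}) ∈ Σ̃_{L′}`, the holomorphoids `X/arith(L′)_{y_1}, …, X/arith(L′)_{y_{ℓ⋇}}` are all distinct
and need not even provide isomorphic pairs of analytic spaces at any prime `w ∈ V^{non}_{L′}`.» (proof: «immediate from [Joshi, 2023a, Theorem 6.2.1]»). Typed: the
arithmeticoids `y_1, …, y_{ℓ⋇}` labelling the holomorphoids of the fixed `X` are PAIRWISE DISTINCT; the «non-isomorphic analytic spaces» clause is prose (reading
note (d)). -/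
@[claim "Joshi2024ATS3" "disputed"]
def Thm631 : Prop := ∀ z ∈ A.adelicAnsatz, Function.Injective z

/-- Local form of Thm. 6.3.1, DERIVED: under valuation scaling, at every `w ∈ V^{odd,ss}` the `w`-components `y′_{w,1}, …, y′_{w,ℓ⋇}` of an Ansatz point are
pairwise distinct, because `|p|_{K_{y′_{w,j}}} = c^{j²}` with `0 < c < 1` and `j ↦ j²` injective on `j ≥ 1`. [claim: Joshi2024ATS3, status: disputed] -/
theorem wComponent_injective_of_valuationScaling (hsc : A.ValuationScaling) {z : Fin A.lstar → A.Arith}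
    (hz : z ∈ A.adelicAnsatz) {w : A.V} (hw : w ∈ A.Voddss) : Function.Injective (A.wComponent z w) := by
  obtain ⟨c, hc0, hc⟩ := hsc z hz w hw
  intro i j hij
  have hc1 : c < 1 := by
    by_contra h
    have hp := (A.normP_pos_lt_one w (z i w)).2
    rw [hc i] at hp
    exact absurd hp (not_lt.2 (one_le_pow₀ (not_lt.1 h)))
  have hzij : z i w = z j w := hij
  have hpow : c ^ ((i.val + 1) ^ 2) = c ^ ((j.val + 1) ^ 2) := by rw [← hc i, ← hc j, hzij]
  have hexp : (i.val + 1) ^ 2 = (j.val + 1) ^ 2 := (pow_right_strictAnti₀ hc0 hc1).injective hpow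
  have hij' : i.val + 1 = j.val + 1 := Nat.pow_left_injective (by norm_num) hexp
  exact Fin.ext (by omega)

/-- **Thm. 6.3.1 DERIVED** from the valuation-scaling hypothesis (Thm. 4.2.2.1 (4)) as soon as `V^{odd,ss}` is non-empty (§3.4.1 works at a `w ∈ V^{odd,ss}`;
[IUTchI] Def. 3.1 (b) requires `V^{bad}_{mod} ≠ ∅`): two adelic points that differ at one `w` differ. [claim: Joshi2024ATS3, status: disputed] -/
theorem thm631_of_valuationScaling (hsc : A.ValuationScaling) (hne : A.Voddss.Nonempty) : A.Thm631 := by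
  intro z hz i j hij
  obtain ⟨w, hw⟩ := hne
  exact A.wComponent_injective_of_valuationScaling hsc hz hw (by simp only [wComponent, hij])

end CollationDatum

/-! ## §6.4 The collation of theta-values: lifting (§6.4.2) and admissible lifts (§6.4.3, Def. 6.4.3.1) -/

/-- Carrier for [J-III] §6.4.2–§6.4.3 at ONE `p`-adic field `E` (in applications `E = E′_w = L′_w`, `w ∈ V^{odd,ss}_p`; p.46 l.34–38), over the ring `B_E =
B_{ℂ_p^♭,E}` (§5.2.3; slot T-09) typed as a parameter `B` with its `O_E`-algebra structure (`OE`): the closed classical points `y′ ∈ |Y_{ℂ_p^♭,E}|` (parameter `Y`)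
with their (principal) maximal ideals `𝔪_{y′} ⊂ B_E` and residue fields `K_{y′} = B_E/𝔪_{y′}` (Prop. 6.6.1, p.48 l.37–41; Rmk. 5.2.2.1); `O_{ℂ_p^♭}` with
`|·|_{ℂ_p^♭}` and the Teichmüller map `[·]` into `W_{O_E}(O_{ℂ_p^♭}) ⊂ B_E` (p.46 l.48–55); the Fréchet norms `|·|_ρ`, `ρ ∈ (0,1]`, with `|[z]|_ρ = |z|_{ℂ_p^♭}`
([J-IIp] Prop. 7.4.2 / [FF18 1.4]); the absolute value of `K_{y′}` with `|ψ_{y′}([z])|_{K_{y′}} = |z|_{ℂ_p^♭}` ([FF18 Prop. 2.2.16–2.2.17], quoted in Rmk. 6.4.2.2);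
the THETA VALUE `ξ_{1;K_{y′}} ∈ K_{y′}` ([Joshi 2023b §6]; p.46 l.45–47) and the TATE PARAMETER `q_{X/E,y′} ∈ K_{y′}` (§6.4 (6.4.1)) as data; and the generator
`t_{K_{y′}}` of the Tate module `T(𝒢(O_{K_{y′}})) ⊂ B_E^{φ=π}` of the fixed Lubin–Tate group `𝒢/O_E` (free `O_E`-module of rank one depending on `y′`, [FF18 Ch. 4];
p.46 l.56–61) with `t_{y′} ∈ 𝔪_{y′}` (Def. 6.4.3.1, p.47 l.82–84). SIGNATURE with the two cited Fargues–Fontaine facts as fields; nothing of Joshi's is asserted.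
Merge-debt: E-t3 `PeriodRingDatum`, slot T-09. [claim: Joshi2024ATS3, status: disputed] -/
structure ThetaLiftDatum (OE B : Type*) [CommRing OE] [CommRing B] [Algebra OE B] (Y : Type*) where
  /-- `𝔪_{y′} ⊂ B_E`: the maximal ideal of the closed classical point `y′` (Rmk. 5.2.2.1; Prop. 6.6.1 «(principal) maximal ideal»). -/
  m : Y → Ideal B
  /-- `𝔪_{y′}` is maximal, so `K_{y′} = B_E ⧸ 𝔪_{y′}` is the residue FIELD. -/
  m_isMaximal : ∀ y : Y, (m y).IsMaximal
  /-- `O_{ℂ_p^♭}` (the elements `z` with Teichmüller lifts `[z]`). -/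
  Cflat : Type
  /-- the Teichmüller map `[·] : O_{ℂ_p^♭} → W_{O_E}(O_{ℂ_p^♭}) ⊂ B_E` (p.46 l.48–55). -/
  teich : Cflat → B
  /-- `|·|_{ℂ_p^♭}`. -/
  absFlat : Cflat → ℝ
  /-- the Fréchet norms `|·|_ρ` on `B_E`, `ρ ∈ (0,1]` (only these `ρ` are read). -/
  norm : ℝ → B → ℝ
  /-- `|[z]|_ρ = |z|_{ℂ_p^♭}` for `ρ ∈ (0,1]` ([J-IIp] Prop. 7.4.2; [FF18 §1.4]; p.46 l.50–53). -/
  norm_teich : ∀ ρ : ℝ, 0 < ρ → ρ ≤ 1 → ∀ z : Cflat, norm ρ (teich z) = absFlat z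
  /-- `|·|_{K_{y′}}` on the residue field `K_{y′} = B_E ⧸ 𝔪_{y′}`. -/
  absK : ∀ y : Y, B ⧸ m y → ℝ
  /-- `|ψ_{y′}([z])|_{K_{y′}} = |z|_{ℂ_p^♭}` ([FF18 Prop. 2.2.16–2.2.17]; Rmk. 6.4.2.2, p.47 l.8–17). -/
  absK_teich : ∀ (y : Y) (z : Cflat), absK y (Ideal.Quotient.mk (m y) (teich z)) = absFlat z
  /-- the theta value `ξ = ξ_1 = ξ_{1;K_{y′}} ∈ K_{y′}` («one of the theta values (see [Joshi, 2023b, § 6]) in `K`», p.46 l.45–47). -/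
  xi : ∀ y : Y, B ⧸ m y
  /-- the Tate parameter `q_{X/E, y′} ∈ K_{y′}` of `X/E` in the arithmetic holomorphic structure `y′` (§6.4 (6.4.1); Prop. 6.6.1). -/
  tate : ∀ y : Y, B ⧸ m y
  /-- the generator `t_{K_{y′}} ∈ B_E` of the Tate module `T(𝒢(O_{K_{y′}})) ⊂ B_E^{φ=π}` (p.46 l.56–61). -/
  tgen : Y → B
  /-- `t_{y′} ∈ 𝔪_{y′}` (Def. 6.4.3.1, p.47 l.82–84; [J-IIp] Prop. 7.4.2: `T_y ⊂ ker η_{K_y}`). -/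
  tgen_mem : ∀ y : Y, tgen y ∈ m y

namespace ThetaLiftDatum

variable {OE B : Type*} [CommRing OE] [CommRing B] [Algebra OE B] {Y : Type*} (D : ThetaLiftDatum OE B Y)

/-- `ψ_{y′} : B_E → B_E/𝔪_{y′} = K_{y′}`, «the natural quotient homomorphism arising by taking quotient modulo the (principal) maximal ideal corresponding to the
closed classical point `y′`» (Prop. 6.6.1, p.48 l.37–41; Def. 6.4.3.1, p.47 l.78–81). [claim: Joshi2024ATS3, status: disputed] -/
abbrev resid (y : Y) : B →+* B ⧸ D.m y := Ideal.Quotient.mk (D.m y)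

/-- `[z]` IS A TEICHMÜLLER LIFT OF `ξ_{1;K_{y′}}` TO `B_E`: `ψ_{y′}([z]) = ξ_{1;K_{y′}}` (p.46 l.48–55; Def. 6.4.3.1, p.47 l.64–81 «Teichmuller lifts to `B_E` of
the theta values … under the natural homomorphism `B_E → B_E/𝔪_{y′_j} = K_{y′_j}`»). [claim: Joshi2024ATS3, status: disputed] -/
def IsTeichLift (y : Y) (z : D.Cflat) : Prop := D.resid y (D.teich z) = D.xi y

/-- **[J-IIp] Thm. 8.1.1 as invoked in [J-III] §6.4.2** (p.46 l.48–53): «one has a Teichmüller lift `[z] ∈ W_{O_E}(O_{ℂ_p^♭})` with the property that for any `ρ ∈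
(0,1] ⊂ ℝ`, one has `|[z]|_ρ = |z|_{ℂ_p^♭} = |ξ|_K`.» HYPOTHESIS (claim of arXiv:2303.01662, unrefereed). -/
@[claim "Joshi2023ATS2Local" "disputed"]
def TeichLiftExists : Prop :=
  ∀ y : Y, ∃ z : D.Cflat, D.IsTeichLift y z ∧ ∀ ρ : ℝ, 0 < ρ → ρ ≤ 1 → D.norm ρ (D.teich z) = D.absK y (D.xi y)

/-- The norm clause of the lift is DERIVED over the signature: a Teichmüller lift `[z]` of `ξ` has `|z|_{ℂ_p^♭} = |ξ|_{K_{y′}}` (by the [FF18 2.2.16] field).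
[claim: Joshi2024ATS3, status: disputed] -/
theorem absFlat_eq_of_isTeichLift {y : Y} {z : D.Cflat} (h : D.IsTeichLift y z) : D.absFlat z = D.absK y (D.xi y) := by
  rw [← D.absK_teich y z]
  exact congrArg (D.absK y) h

/-- … and `|[z]|_ρ = |ξ|_{K_{y′}}` for every `ρ ∈ (0,1]` (p.46 l.50–53), DERIVED. [claim: Joshi2024ATS3, status: disputed] -/
theorem norm_teich_of_isTeichLift {y : Y} {z : D.Cflat} (h : D.IsTeichLift y z) {ρ : ℝ} (h0 : 0 < ρ) (h1 : ρ ≤ 1) :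
    D.norm ρ (D.teich z) = D.absK y (D.xi y) := by
  rw [D.norm_teich ρ h0 h1 z, D.absFlat_eq_of_isTeichLift h]

/-- Over this signature the claim reduces to the bare existence of Teichmüller lifts of `ξ_{1;K_{y′}}`. [claim: Joshi2024ATS3, status: disputed] -/
theorem teichLiftExists_iff : D.TeichLiftExists ↔ ∀ y : Y, ∃ z : D.Cflat, D.IsTeichLift y z := by
  refine ⟨fun h y => ?_, fun h y => ?_⟩
  · obtain ⟨z, hz, -⟩ := h y
    exact ⟨z, hz⟩
  · obtain ⟨z, hz⟩ := h y
    exact ⟨z, hz, fun ρ h0 h1 => D.norm_teich_of_isTeichLift hz h0 h1⟩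

/-- **[J-III] Rmk. 6.4.2.2** (p.47 l.8–17): «if `[z], [z′]` are two lifts of `ξ ∈ K_{y′}` to `B_E` then `|z|_{ℂ_p^♭} = |z′|_{ℂ_p^♭}` by [Fargues and Fontaine, 2018,
Proposition 2.2.16]. Hence the absolute values of `z, z′ ∈ ℂ_p^♭` for any pair of Teichmüller lifts `[z], [z′]` of `ξ ∈ K` are independent of the choice of the
Teichmüller lifts.» -/
@[claim "Joshi2024ATS3" "disputed"]
def Rmk6422 : Prop := ∀ (y : Y) (z z' : D.Cflat), D.IsTeichLift y z → D.IsTeichLift y z' → D.absFlat z = D.absFlat z'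

/-- Rmk. 6.4.2.2 HOLDS over the typed signature (DISCHARGED row). [claim: Joshi2024ATS3, status: disputed] -/
theorem rmk6422_holds : D.Rmk6422 := fun _ _ _ hz hz' => by
  rw [D.absFlat_eq_of_isTeichLift hz, D.absFlat_eq_of_isTeichLift hz']

/-- **The lifts of interest (6.4.2.1)** (p.46 l.55–p.47 l.7): «Such a lift is not uniquely defined … one can add to `[z]` any element of the Tate-module `T(𝒢(O_K))
⊂ B_E^{φ=π}` … Then the lifts of `ξ` to `B_E` of interest to us are the lifts of the form `Ξ = [z] + O_E·t_{K_{y′}}`», labelled `Ξ^z_{K_{y′}}` / `Ξ_{K_{y′}}`. Typed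
as the subset `[z] + O_E·t_{y′} ⊂ B_E`. [claim: Joshi2024ATS3, status: disputed] -/
@[claim "Joshi2024ATS3" "disputed"]
def liftSet (y : Y) (z : D.Cflat) : Set B := {x | ∃ l : OE, x = D.teich z + l • D.tgen y}

/-- `O_E·t_{y′} ⊂ 𝔪_{y′}`: the Tate-module translates die in the residue field. [claim: Joshi2024ATS3, status: disputed] -/
theorem smul_tgen_mem (y : Y) (l : OE) : l • D.tgen y ∈ D.m y := by
  rw [Algebra.smul_def]
  exact Ideal.mul_mem_left _ _ (D.tgen_mem y)

/-- Every element of `Ξ^z_{K_{y′}} = [z] + O_E·t_{y′}` is again a lift of `ξ_{1;K_{y′}}`: `ψ_{y′}([z] + λ t_{y′}) = ψ_{y′}([z]) = ξ` since `t_{y′} ∈ 𝔪_{y′}` —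
DERIVED (this is why (6.4.2.1) consists of lifts). [claim: Joshi2024ATS3, status: disputed] -/
theorem resid_eq_xi_of_mem_liftSet {y : Y} {z : D.Cflat} (hz : D.IsTeichLift y z) {x : B} (hx : x ∈ D.liftSet y z) :
    D.resid y x = D.xi y := by
  obtain ⟨l, rfl⟩ := hx
  rw [map_add, Ideal.Quotient.eq_zero_iff_mem.2 (D.smul_tgen_mem y l), add_zero]
  exact hz

/-- §6.4 (6.4.1) (p.45 l.9–24): the tuple of TATE PARAMETERS `(q_{w,arith(y_1)}, …, q_{w,arith(y_{ℓ⋇})})` of an `ℓ⋇`-tuple of points — the data one «wants to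
collate … in a suitable container set» although «the individual elements … do not live in a natural common set» (p.45 l.25–28): the `j`-th entry lives in ITS OWN
residue field `K_{y′_j} = B_E ⧸ 𝔪_{y′_j}` (dependent type). [claim: Joshi2024ATS3, status: disputed] -/
@[claim "Joshi2024ATS3" "disputed"]
def tateTuple {n : ℕ} (y : Fin n → Y) : ∀ j : Fin n, B ⧸ D.m (y j) := fun j => D.tate (y j)

/-- **[J-III] Def. 6.4.3.1 (6.4.3.2)** (p.47 l.42–86): the ADMISSIBLE LIFT OF THETA-VALUES (admissible theta-values-lift) `Ξ^{z_1,…,z_{ℓ⋇}}_{λ,z,w} =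
(Ξ^{z_1}_{λ,K_{y′_1}} := [z_1] + i_1(λ) t_{K_{y′_1}}, …, Ξ^{z_{ℓ⋇}}_{λ,K_{y′_{ℓ⋇}}} := [z_{ℓ⋇}] + i_{ℓ⋇}(λ) t_{K_{y′_{ℓ⋇}}}) ∈ B_E^{ℓ⋇}`, «where `λ ∈ O_E`» (ONE
`λ`), as a function of the tuple of points `(y′_j)`, the tuple `(z_j)` and `λ`; `i_j(λ) t` typed as the `O_E`-action (reading note (a)). Notation (p.48 l.1–13):
`Ξ_{λ,z,w}`, `Ξ_{z,w}`, `Ξ = (Ξ_{K_{y′_1}}, …, Ξ_{K_{y′_{ℓ⋇}}})`. Rmk. 6.4.3.3 (p.48 l.14–16): «each `Ξ_{λ,z,w}` is the analog of Mochizuki's Θ-Pilot Object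
[IUTchIII, Def. 3.8 (i)]» (DICTIONARY D-t10-1). [claim: Joshi2024ATS3, status: disputed] -/
@[claim "Joshi2024ATS3" "disputed"]
def admissibleLift {n : ℕ} (y : Fin n → Y) (z : Fin n → D.Cflat) (l : OE) : Fin n → B :=
  fun j => D.teich (z j) + l • D.tgen (y j)

/-- `Ξ` IS AN ADMISSIBLE LIFT OF THETA-VALUES over the tuple `(y′_1, …, y′_{ℓ⋇})` relative to the local Ansatz `An ⊂ Y^{ℓ⋇}` (Def. 6.4.3.1 with its side conditions,
p.47 l.21–32 and l.62–84): the tuple of points lies in Mochizuki's Ansatz `Σ̃^E_{ℂ_p^♭}` for `B_E`, and `Ξ = Ξ_{λ,z,w}` for some `λ ∈ O_E` and some Teichmüller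
lifts `[z_j]` of the theta values `ξ_{1;K_{y′_j}}`. [claim: Joshi2024ATS3, status: disputed] -/
@[claim "Joshi2024ATS3" "disputed"]
def IsAdmissibleLift {n : ℕ} (An : Set (Fin n → Y)) (y : Fin n → Y) (Ξ : Fin n → B) : Prop :=
  y ∈ An ∧ ∃ (l : OE) (z : Fin n → D.Cflat), (∀ j, D.IsTeichLift (y j) (z j)) ∧ Ξ = D.admissibleLift y z l

/-- The SET of admissible lifts of theta-values over `(y′_j) ∈ An` (p.47 l.18–20 «the set of admissible lifts of theta-values … to `B_E^{ℓ⋇}`»). [claim: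
Joshi2024ATS3, status: disputed] -/
@[claim "Joshi2024ATS3" "disputed"]
def admissibleLifts {n : ℕ} (An : Set (Fin n → Y)) (y : Fin n → Y) : Set (Fin n → B) := {Ξ | D.IsAdmissibleLift An y Ξ}

/-- Each coordinate of `Ξ_{λ,z,w}` is one of the lifts of interest (6.4.2.1): `Ξ_j ∈ [z_j] + O_E·t_{y′_j}`. [claim: Joshi2024ATS3, status: disputed] -/
theorem admissibleLift_mem_liftSet {n : ℕ} (y : Fin n → Y) (z : Fin n → D.Cflat) (l : OE) (j : Fin n) :
    D.admissibleLift y z l j ∈ D.liftSet (y j) (z j) := ⟨l, rfl⟩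

/-- **`ψ_j(Ξ_j) = ξ_{1;K_{y′_j}}`** — the first equality of [J-III] Prop. 6.6.1 (p.48 l.28–49, slot T-11) ALREADY HOLDS over this signature: reducing the `j`-th
coordinate of an admissible lift modulo `𝔪_{y′_j}` returns the theta value, since `t_{y′_j} ∈ 𝔪_{y′_j}`. DERIVED. [claim: Joshi2024ATS3, status: disputed] -/
theorem resid_admissibleLift {n : ℕ} {y : Fin n → Y} {z : Fin n → D.Cflat} (hz : ∀ j, D.IsTeichLift (y j) (z j)) (l : OE)
    (j : Fin n) : D.resid (y j) (D.admissibleLift y z l j) = D.xi (y j) :=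
  D.resid_eq_xi_of_mem_liftSet (hz j) (D.admissibleLift_mem_liftSet y z l j)

/-- The same for any admissible lift `Ξ` over `(y′_j)`. [claim: Joshi2024ATS3, status: disputed] -/
theorem resid_of_isAdmissibleLift {n : ℕ} {An : Set (Fin n → Y)} {y : Fin n → Y} {Ξ : Fin n → B}
    (h : D.IsAdmissibleLift An y Ξ) (j : Fin n) : D.resid (y j) (Ξ j) = D.xi (y j) := by
  obtain ⟨-, l, z, hz, rfl⟩ := h
  exact D.resid_admissibleLift hz l j

/-- Admissible lifts EXIST over every Ansatz tuple as soon as Teichmüller lifts of the theta values exist ([J-IIp] Thm. 8.1.1 as hypothesis): take `λ = 0`. [claim: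
Joshi2024ATS3, status: disputed] -/
theorem admissibleLifts_nonempty_of_teichLiftExists (hT : D.TeichLiftExists) {n : ℕ} {An : Set (Fin n → Y)} {y : Fin n → Y}
    (hy : y ∈ An) : (D.admissibleLifts An y).Nonempty := by
  choose z hz using fun j : Fin n => (D.teichLiftExists_iff.1 hT) (y j)
  exact ⟨D.admissibleLift y z 0, hy, 0, z, hz, rfl⟩

end ThetaLiftDatum

namespace CollationDatum

variable (A : CollationDatum)

/-- [J-III] §6.4.1–§6.4.3 assembled (p.45 l.43–p.48 l.13): for a Θ_gau-link `z ∈ Σ̃_{L′}`, a prime `w ∈ V^{odd,ss}_p` and lift data `D` over `B_{E′_w}` on the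
points `|Y_{ℂ_p^♭,L′_w}|`, `Ξ ∈ B_{E′_w}^{ℓ⋇}` IS AN ADMISSIBLE LIFT OF THETA-VALUES AT `w` FOR `z`, i.e. `Ξ = Ξ_{λ,z,w}`: an admissible lift over the `w`-component
`(y′_1, …, y′_{ℓ⋇}) = (y_{w,1}, …, y_{w,ℓ⋇})` relative to the local Ansatz at `w`. [claim: Joshi2024ATS3, status: disputed] -/
@[claim "Joshi2024ATS3" "disputed"]
def IsAdmissibleLiftAt {OE B : Type*} [CommRing OE] [CommRing B] [Algebra OE B] (w : A.V) (D : ThetaLiftDatum OE B (A.Y w))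
    (z : Fin A.lstar → A.Arith) (Ξ : Fin A.lstar → B) : Prop :=
  z ∈ A.adelicAnsatz ∧ w ∈ A.Voddss ∧ D.IsAdmissibleLift (A.localAnsatz w) (A.wComponent z w) Ξ

/-- For every Θ_gau-link and every `w ∈ V^{odd,ss}`, admissible lifts at `w` exist once Teichmüller lifts of the theta values exist (DERIVED:
`wComponent_mem_localAnsatz` + `λ = 0`). [claim: Joshi2024ATS3, status: disputed] -/
theorem exists_isAdmissibleLiftAt {OE B : Type*} [CommRing OE] [CommRing B] [Algebra OE B] {w : A.V}
    (D : ThetaLiftDatum OE B (A.Y w)) (hT : D.TeichLiftExists) {z : Fin A.lstar → A.Arith} (hz : z ∈ A.adelicAnsatz)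
    (hw : w ∈ A.Voddss) : ∃ Ξ : Fin A.lstar → B, A.IsAdmissibleLiftAt w D z Ξ := by
  obtain ⟨Ξ, hΞ⟩ := D.admissibleLifts_nonempty_of_teichLiftExists hT (A.wComponent_mem_localAnsatz hz hw)
  exact ⟨Ξ, hz, hw, hΞ⟩

end CollationDatum

end Summit.ABC.IUTFork.Joshi.ATS3
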